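import Literature.Analysis.FluidPDE.Seregin2020SwirlEnergyInequality
import Literature.Analysis.FluidPDE.LeiZhang2011Cutoff
import HarnessLib

/-!
# Seregin 2020, proof of Thm. 2.1: the cut-offs of the Moser iteration for the swirl

Analysis/FluidPDE proofs file (theorems only; no definitions, no named facts), on the discharge
path of the named fact `Literature.Analysis.FluidPDE.Seregin2020_axisymmetricSingularPoint_typeII`
(G. Seregin, *Local regularity of axisymmetric solutions to the Navier–Stokes equations*, Anal.
Math. Phys. 10 (2020), Paper No. 46 = arXiv:2006.04140, Thm. 2.1).

The printed proof (arXiv pp. 4–6) uses three cut-offs: "`ψ = ψ(x,t)`, vanishing in a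
neighbourhood of the parabolic boundary of `Q`", chosen later as `ψ(x,t) = Φ(x)χ(t)` with
`Φ = 1` in `𝒞(r)`, `Φ = 0` outside `𝒞(r₁)`, `|∇Φ| ≤ c/(r₁-r)`, `χ(t) = 0` for `t ≤ -r₁²`,
`χ(t) = 1` for `t > -r²`, `|∂ₜχ| ≤ c/(r₁-r)²`; and "`φ = φ(x')`, vanishing in a neighbourhood of
the axis of symmetry … `φ(x') = 0` if `0 < |x'| < ε/2`, `φ(x') = 1` if `|x'| > ε`,
`|∇ᵏφ| ≤ cε^{-k}`". This file records them in the tree's vocabulary: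

* the spatial cut-off is the tree's radial `radialCutoff r r₁` (balls instead of the flat
  cylinders `𝒞(r)` of the paper — immaterial —, with `|∇Φ| ≤ C/(r₁-r)`,
  `LeiZhang2011.exists_norm_gradient_radialCutoff_le`, and radially non-increasing,
  `LeiZhang2011.radialCutoff_mul_fderiv_eR_nonpos`, so that the drift `(2/ϱ)∂_ϱ` has a sign on it);
* the axis cut-off `φ_ε(x) = smoothTransition((2/ε)ϱ(x) - 1)` (`axisCutoff_props`: smooth,
  `0 ≤ φ_ε ≤ 1`, `φ_ε = 0` for `ϱ ≤ ε/2`, `φ_ε = 1` for `ϱ ≥ ε`, `∂_ϱφ_ε ≥ 0`, `|∇φ_ε| ≤ 2C_T/ε`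
  and `∇φ_ε = 0` off the closed shell `ε/2 ≤ ϱ ≤ ε`);
* the product `Θ = Φ φ_ε` (`productCutoff_props`): `C¹`, compactly supported in
  `B̄(0,r₁) ∩ {ϱ ≥ ε/2}`, with the pointwise bounds used to estimate the right-hand side of the
  energy inequality: `|∇Θ|² ≤ 2|∇Φ|² + 2Φ²|∇φ_ε|²`, `‖∇Θ²‖ ≤ 2Θ(|∇Φ| + Φ|∇φ_ε|)`,
  `(∂_ϱΘ²)⁺ ≤ 2Φ²φ_ε ∂_ϱφ_ε` (the radial part is `≤ 0`).

## References

* G. Seregin, Anal. Math. Phys. 10 (2020), Paper 46 = arXiv:2006.04140, proof of Thm. 2.1,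
  pp. 4–6 (the cut-offs `ψ = Φχ` and `φ`). [`Seregin2020`]
* Z. Lei, Q. S. Zhang, J. Funct. Anal. 261 (2011) = arXiv:1011.5066, §2 (2.1) (radial cut-offs).
  [`LeiZhang2011`]
-/

noncomputable section

open MeasureTheory Set Function Filter Topology TopologicalSpace Metric WithLp
open scoped NNReal ENNReal ContDiff InnerProductSpace RealInnerProductSpace

namespace Literature.Analysis.FluidPDE

namespace Seregin2020

open SereginZajaczkowski2007 SereginSverak2009 LeiZhang2011

/-! ### The radial unit vector -/

/-- `‖e_ϱ(x)‖ = 1` off the axis. [folklore] -/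
private theorem norm_eR_of_ne {x : EuclideanSpace ℝ (Fin 3)} (hx : cylRadius x ≠ 0) : ‖eR x‖ = 1 := by
  have h : ‖eR x‖ ^ 2 = 1 := by rw [← real_inner_self_eq_norm_sq, inner_eR_self hx]
  have h0 : 0 ≤ ‖eR x‖ := norm_nonneg _
  nlinarith [h, h0]

/-! ### The axis cut-off `φ_ε(x) = smoothTransition ((2/ε)ϱ - 1)` -/

/-- **The axis cut-off of Seregin's proof** ("`φ(x') = 0` if `0 < |x'| < ε/2`, `φ(x') = 1` if
`|x'| > ε`, and `|∇ᵏφ| ≤ cε^{-k}`", arXiv p. 5), realised as `φ_ε(x) = smoothTransition((2/ε)ϱ(x) - 1)`: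
for `ε > 0` it is `C^∞` (constant near the axis, where `ϱ` is not differentiable), `0 ≤ φ_ε ≤ 1`,
`φ_ε(x) = 0` for `ϱ(x) ≤ ε/2`, `φ_ε(x) = 1` for `ε ≤ ϱ(x)`; `∂_ϱφ_ε ≥ 0`, `∂_ϱφ_ε ≤ 2C_T/ε`,
`‖∇φ_ε‖ ≤ 2C_T/ε` (`C_T` a bound of `|smoothTransition'|`), and `∇φ_ε(x) = 0` (hence
`∂_ϱφ_ε(x) = 0`) unless `ε/2 ≤ ϱ(x) ≤ ε`.
[cite: Seregin2020, proof of Thm. 2.1 (arXiv p. 5), the cut-off φ of the axis] -/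
theorem axisCutoff_props {ε : ℝ} (hε : 0 < ε) {CT : ℝ} (hCT : ∀ t, |deriv Real.smoothTransition t| ≤ CT)
    {φ : EuclideanSpace ℝ (Fin 3) → ℝ} (hφ : ∀ x, φ x = Real.smoothTransition (2 / ε * cylRadius x - 1)) :
    ContDiff ℝ ∞ φ ∧ (∀ x, 0 ≤ φ x ∧ φ x ≤ 1) ∧
      (∀ x, cylRadius x ≤ ε / 2 → φ x = 0) ∧ (∀ x, ε ≤ cylRadius x → φ x = 1) ∧
      (∀ x, 0 ≤ fderiv ℝ φ x (eR x)) ∧ (∀ x, fderiv ℝ φ x (eR x) ≤ 2 * CT / ε) ∧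
      (∀ x, ‖gradient φ x‖ ≤ 2 * CT / ε) ∧
      (∀ x, (cylRadius x < ε / 2 ∨ ε < cylRadius x) → fderiv ℝ φ x = 0) := by
  have hfun : φ = fun x => Real.smoothTransition (2 / ε * cylRadius x - 1) := funext hφ
  have hCT0 : 0 ≤ CT := (abs_nonneg _).trans (hCT 0)
  have h2ε : 0 ≤ 2 / ε := div_nonneg zero_le_two hε.le
  -- values
  have hzero : ∀ x, cylRadius x ≤ ε / 2 → φ x = 0 := by
    intro x hx
    rw [hφ]
    refine Real.smoothTransition.zero_of_nonpos ?_
    rw [sub_nonpos, div_mul_eq_mul_div, div_le_one hε]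
    linarith
  have hone : ∀ x, ε ≤ cylRadius x → φ x = 1 := by
    intro x hx
    rw [hφ]
    refine Real.smoothTransition.one_of_one_le ?_
    rw [le_sub_iff_add_le, div_mul_eq_mul_div, le_div_iff₀ hε]
    linarith
  -- local constancy off the closed shell
  have hev0 : ∀ x, cylRadius x < ε / 2 → φ =ᶠ[𝓝 x] fun _ => 0 := by
    intro x hx
    filter_upwards [(isOpen_lt continuous_cylRadius continuous_const).mem_nhds hx] with y hy
    exact hzero y (le_of_lt hy)
  have hev1 : ∀ x, ε < cylRadius x → φ =ᶠ[𝓝 x] fun _ => 1 := by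
    intro x hx
    filter_upwards [(isOpen_lt continuous_const continuous_cylRadius).mem_nhds hx] with y hy
    exact hone y (le_of_lt hy)
  -- the derivative off the axis
  have hderiv : ∀ x, cylRadius x ≠ 0 → HasFDerivAt φ
      ((deriv Real.smoothTransition (2 / ε * cylRadius x - 1) * (2 / ε)) • innerSL ℝ (eR x)) x := by
    intro x hx
    have ha : HasFDerivAt (fun y : EuclideanSpace ℝ (Fin 3) => 2 / ε * cylRadius y - 1)
        ((2 / ε) • innerSL ℝ (eR x)) x :=
      ((hasFDerivAt_cylRadius hx).const_mul (2 / ε)).sub_const 1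
    have hT : HasDerivAt Real.smoothTransition (deriv Real.smoothTransition (2 / ε * cylRadius x - 1))
        (2 / ε * cylRadius x - 1) :=
      ((Real.smoothTransition.contDiff (n := 1)).differentiable one_ne_zero _).hasDerivAt
    have h := hT.comp_hasFDerivAt x ha
    rw [hfun]
    refine h.congr_fderiv ?_
    rw [smul_smul]
  -- smoothness
  have hsmooth : ContDiff ℝ ∞ φ := by
    rw [contDiff_iff_contDiffAt]
    intro x
    by_cases hx : cylRadius x < ε / 2
    · exact (contDiffAt_const (c := (0 : ℝ))).congr_of_eventuallyEq (hev0 x hx)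
    · have hx0 : cylRadius x ≠ 0 := by
        intro h0
        apply hx
        rw [h0]
        linarith
      rw [hfun]
      exact Real.smoothTransition.contDiff.contDiffAt.comp x
        ((contDiffAt_const.mul (contDiffAt_cylRadius hx0)).sub contDiffAt_const)
  -- the derivative in the directions `eR`, and the gradient
  have hfderiv_off : ∀ x, cylRadius x ≠ 0 → fderiv ℝ φ x =
      (deriv Real.smoothTransition (2 / ε * cylRadius x - 1) * (2 / ε)) • innerSL ℝ (eR x) :=
    fun x hx => (hderiv x hx).fderiv
  have hfderiv_axis : ∀ x, cylRadius x = 0 → fderiv ℝ φ x = 0 := by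
    intro x hx
    have hlt : cylRadius x < ε / 2 := by rw [hx]; linarith
    rw [(hev0 x hlt).fderiv_eq]
    simp
  have hrad : ∀ x, fderiv ℝ φ x (eR x) =
      if cylRadius x = 0 then 0 else deriv Real.smoothTransition (2 / ε * cylRadius x - 1) * (2 / ε) := by
    intro x
    by_cases hx : cylRadius x = 0
    · rw [if_pos hx, hfderiv_axis x hx]; rfl
    · rw [if_neg hx, hfderiv_off x hx, FunLike.coe_smul, Pi.smul_apply, innerSL_apply_apply,
        inner_eR_self hx, smul_eq_mul, mul_one]
  refine ⟨hsmooth, fun x => ?_, hzero, hone, fun x => ?_, fun x => ?_, fun x => ?_, fun x hx => ?_⟩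
  · rw [hφ]
    exact ⟨Real.smoothTransition.nonneg _, Real.smoothTransition.le_one _⟩
  · rw [hrad x]
    split_ifs
    · exact le_rfl
    · exact mul_nonneg (deriv_smoothTransition_nonneg _) h2ε
  · rw [hrad x]
    split_ifs
    · positivity
    · calc deriv Real.smoothTransition (2 / ε * cylRadius x - 1) * (2 / ε)
          ≤ CT * (2 / ε) := mul_le_mul_of_nonneg_right ((le_abs_self _).trans (hCT _)) h2ε
        _ = 2 * CT / ε := by ring
  · rw [gradient, LinearIsometryEquiv.norm_map]
    by_cases hx : cylRadius x = 0
    · rw [hfderiv_axis x hx, norm_zero]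
      positivity
    · rw [hfderiv_off x hx, norm_smul, innerSL_apply_norm, norm_eR_of_ne hx, mul_one, Real.norm_eq_abs, abs_mul,
        abs_of_nonneg h2ε]
      calc |deriv Real.smoothTransition (2 / ε * cylRadius x - 1)| * (2 / ε)
          ≤ CT * (2 / ε) := mul_le_mul_of_nonneg_right (hCT _) h2ε
        _ = 2 * CT / ε := by ring
  · rcases hx with hx | hx
    · rw [(hev0 x hx).fderiv_eq]
      simp
    · rw [(hev1 x hx).fderiv_eq]
      simp

/-! ### The product `Θ = Φ φ_ε` -/

/-- **The spatial weight `Θ = Φ · φ_ε` of the energy method** (`Φ = radialCutoff r r₁` the radial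
cut-off of the ball `B(0,r)` inside `B(0,r₁)`, `φ_ε` the axis cut-off): for `0 ≤ r < r₁` and a
`C^∞` axis cut-off `φ` with `0 ≤ φ ≤ 1`, `φ = 0` on `{ϱ ≤ ε/2}`, `∂_ϱφ ≥ 0`: `Θ` is `C¹`,
compactly supported with `tsupport Θ ⊆ B̄(0,r₁) ∩ {ε/2 ≤ ϱ}`, `0 ≤ Θ ≤ 1`, `Θ ≤ Φ`, and
pointwise `‖∇Θ‖² ≤ 2‖∇Φ‖² + 2Φ²‖∇φ‖²`, `‖∇(Θ²)‖ ≤ 2Θ(‖∇Φ‖ + Φ‖∇φ‖)`,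
`(∂_ϱ(Θ²))⁺ ≤ 2Φ² φ ∂_ϱφ` (the radial cut-off is radially non-increasing,
`LeiZhang2011.radialCutoff_mul_fderiv_eR_nonpos`). [cite: Seregin2020, proof of Thm. 2.1 (arXiv pp. 5–6), the cut-offs ψ⁴φ²] -/
theorem productCutoff_props {r r₁ ε : ℝ} (hr : 0 ≤ r) (hrr₁ : r < r₁)
    {φ : EuclideanSpace ℝ (Fin 3) → ℝ} (hφC : ContDiff ℝ ∞ φ) (hφ01 : ∀ x, 0 ≤ φ x ∧ φ x ≤ 1)
    (hφ0 : ∀ x, cylRadius x ≤ ε / 2 → φ x = 0) (hφr : ∀ x, 0 ≤ fderiv ℝ φ x (eR x))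
    {Θ : EuclideanSpace ℝ (Fin 3) → ℝ} (hΘ : ∀ x, Θ x = radialCutoff r r₁ x * φ x) :
    ContDiff ℝ 1 Θ ∧ HasCompactSupport Θ ∧
      tsupport Θ ⊆ closedBall (0 : EuclideanSpace ℝ (Fin 3)) r₁ ∩ {x | ε / 2 ≤ cylRadius x} ∧
      (∀ x, 0 ≤ Θ x ∧ Θ x ≤ 1) ∧ (∀ x, Θ x ≤ radialCutoff r r₁ x) ∧
      (∀ x, ‖gradient Θ x‖ ^ 2 ≤
        2 * ‖gradient (radialCutoff r r₁ : EuclideanSpace ℝ (Fin 3) → ℝ) x‖ ^ 2 +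
          2 * (radialCutoff r r₁ x ^ 2 * ‖gradient φ x‖ ^ 2)) ∧
      (∀ x, ‖gradient (fun y => Θ y ^ 2) x‖ ≤
        2 * Θ x * (‖gradient (radialCutoff r r₁ : EuclideanSpace ℝ (Fin 3) → ℝ) x‖ + radialCutoff r r₁ x * ‖gradient φ x‖)) ∧
      (∀ x, max (fderiv ℝ (fun y => Θ y ^ 2) x (eR x)) 0 ≤
        2 * (radialCutoff r r₁ x ^ 2 * (φ x * fderiv ℝ φ x (eR x)))) := by
  set Φ : EuclideanSpace ℝ (Fin 3) → ℝ := radialCutoff r r₁ with hΦdef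
  have hΘfun : Θ = fun x => Φ x * φ x := funext hΘ
  have hΦC : ContDiff ℝ ∞ Φ := radialCutoff_contDiff r r₁
  have hΦ1 : ContDiff ℝ 1 Φ := hΦC.of_le (by norm_cast)
  have hφ1 : ContDiff ℝ 1 φ := hφC.of_le (by norm_cast)
  have hΦ01 : ∀ x, 0 ≤ Φ x ∧ Φ x ≤ 1 := fun x => ⟨radialCutoff_nonneg _ _ _, radialCutoff_le_one _ _ _⟩
  have hΦc : HasCompactSupport Φ := hasCompactSupport_radialCutoff hr hrr₁
  have hΦK : tsupport Φ ⊆ closedBall (0 : EuclideanSpace ℝ (Fin 3)) r₁ := tsupport_radialCutoff_subset hr hrr₁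
  -- smoothness and support
  have hΘC : ContDiff ℝ 1 Θ := by rw [hΘfun]; exact hΦ1.mul hφ1
  have hΘc : HasCompactSupport Θ := by rw [hΘfun]; exact hΦc.mul_right
  have hφK : tsupport φ ⊆ {x | ε / 2 ≤ cylRadius x} := by
    refine closure_minimal (fun x hx => ?_) (isClosed_le continuous_const continuous_cylRadius)
    by_contra h
    simp only [mem_setOf_eq, not_le] at h
    exact hx (hφ0 x h.le)
  have hΘK : tsupport Θ ⊆ closedBall (0 : EuclideanSpace ℝ (Fin 3)) r₁ ∩ {x | ε / 2 ≤ cylRadius x} := by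
    rw [hΘfun]
    exact subset_inter (tsupport_mul_subset_left.trans hΦK) (tsupport_mul_subset_right.trans hφK)
  -- values
  have hΘ01 : ∀ x, 0 ≤ Θ x ∧ Θ x ≤ 1 := fun x => by
    rw [hΘ]
    obtain ⟨h1, h2⟩ := hΦ01 x
    obtain ⟨h3, h4⟩ := hφ01 x
    exact ⟨mul_nonneg h1 h3, by nlinarith⟩
  have hΘΦ : ∀ x, Θ x ≤ Φ x := fun x => by
    rw [hΘ]
    obtain ⟨h1, _⟩ := hΦ01 x
    obtain ⟨_, h4⟩ := hφ01 x
    calc Φ x * φ x ≤ Φ x * 1 := mul_le_mul_of_nonneg_left h4 h1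
      _ = Φ x := mul_one _
  -- derivatives
  have hΦd : ∀ x, DifferentiableAt ℝ Φ x := fun x => (hΦ1.differentiable one_ne_zero) x
  have hφd : ∀ x, DifferentiableAt ℝ φ x := fun x => (hφ1.differentiable one_ne_zero) x
  have hΘd : ∀ x, DifferentiableAt ℝ Θ x := fun x => (hΘC.differentiable one_ne_zero) x
  have hgradΘ : ∀ x, gradient Θ x = φ x • gradient Φ x + Φ x • gradient φ x := by
    intro x
    rw [hΘfun, gradient_mul_apply' (hΦd x) (hφd x), add_comm]
  have hgrad_norm : ∀ x, ‖gradient Θ x‖ ≤ ‖gradient Φ x‖ + Φ x * ‖gradient φ x‖ := by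
    intro x
    rw [hgradΘ x]
    refine (norm_add_le _ _).trans ?_
    rw [norm_smul, norm_smul, Real.norm_eq_abs, Real.norm_eq_abs, abs_of_nonneg (hφ01 x).1,
      abs_of_nonneg (hΦ01 x).1]
    have : φ x * ‖gradient Φ x‖ ≤ 1 * ‖gradient Φ x‖ :=
      mul_le_mul_of_nonneg_right (hφ01 x).2 (norm_nonneg _)
    linarith
  have hgrad_sq : ∀ x, ‖gradient Θ x‖ ^ 2 ≤ 2 * ‖gradient Φ x‖ ^ 2 + 2 * (Φ x ^ 2 * ‖gradient φ x‖ ^ 2) := by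
    intro x
    have h := hgrad_norm x
    have h0 : 0 ≤ ‖gradient Φ x‖ + Φ x * ‖gradient φ x‖ := by
      have := (hΦ01 x).1; positivity
    have h1 : ‖gradient Θ x‖ ^ 2 ≤ (‖gradient Φ x‖ + Φ x * ‖gradient φ x‖) ^ 2 :=
      pow_le_pow_left₀ (norm_nonneg _) h 2
    nlinarith [sq_nonneg (‖gradient Φ x‖ - Φ x * ‖gradient φ x‖)]
  have hgrad2 : ∀ x, ‖gradient (fun y => Θ y ^ 2) x‖ ≤ 2 * Θ x * (‖gradient Φ x‖ + Φ x * ‖gradient φ x‖) := by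
    intro x
    rw [gradient_sq_apply hΘC x, norm_smul, Real.norm_eq_abs, abs_of_nonneg (by linarith [(hΘ01 x).1])]
    exact mul_le_mul_of_nonneg_left (hgrad_norm x) (by linarith [(hΘ01 x).1])
  -- the radial derivative of `Θ²`
  have hfderiv2 : ∀ x, fderiv ℝ (fun y => Θ y ^ 2) x (eR x) =
      2 * (φ x ^ 2 * (Φ x * fderiv ℝ Φ x (eR x))) + 2 * (Φ x ^ 2 * (φ x * fderiv ℝ φ x (eR x))) := by
    intro x
    have e : (fun y => Θ y ^ 2) = fun y => Φ y ^ 2 * φ y ^ 2 := by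
      funext y; rw [hΘ]; ring
    rw [e]
    have hΦ2d : DifferentiableAt ℝ (fun y => Φ y ^ 2) x := (hΦd x).pow 2
    have hφ2d : DifferentiableAt ℝ (fun y => φ y ^ 2) x := (hφd x).pow 2
    rw [fderiv_fun_mul hΦ2d hφ2d]
    have e1 : fderiv ℝ (fun y => Φ y ^ 2) x = (2 * Φ x) • fderiv ℝ Φ x := by
      have h := ((hΦd x).hasFDerivAt.pow 2).fderiv
      rw [h]
      simp
    have e2 : fderiv ℝ (fun y => φ y ^ 2) x = (2 * φ x) • fderiv ℝ φ x := by
      have h := ((hφd x).hasFDerivAt.pow 2).fderiv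
      rw [h]
      simp
    rw [e1, e2]
    show (Φ x ^ 2 • ((2 * φ x) • fderiv ℝ φ x)) (eR x) + (φ x ^ 2 • ((2 * Φ x) • fderiv ℝ Φ x)) (eR x) = _
    simp only [FunLike.coe_smul, Pi.smul_apply, smul_eq_mul]
    ring
  have hpos : ∀ x, max (fderiv ℝ (fun y => Θ y ^ 2) x (eR x)) 0 ≤ 2 * (Φ x ^ 2 * (φ x * fderiv ℝ φ x (eR x))) := by
    intro x
    have h1 : Φ x * fderiv ℝ Φ x (eR x) ≤ 0 := radialCutoff_mul_fderiv_eR_nonpos hrr₁ hr x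
    have h2 : 0 ≤ φ x * fderiv ℝ φ x (eR x) := mul_nonneg (hφ01 x).1 (hφr x)
    have h3 : 0 ≤ 2 * (Φ x ^ 2 * (φ x * fderiv ℝ φ x (eR x))) := by positivity
    refine max_le ?_ h3
    rw [hfderiv2 x]
    have h4 : φ x ^ 2 * (Φ x * fderiv ℝ Φ x (eR x)) ≤ 0 := mul_nonpos_of_nonneg_of_nonpos (sq_nonneg (φ x)) h1
    linarith
  exact ⟨hΘC, hΘc, hΘK, hΘ01, hΘΦ, hgrad_sq, hgrad2, hpos⟩

end Seregin2020

end Literature.Analysis.FluidPDE
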